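import Literature.MathematicalPhysics.QuantumFieldTheory.O2NeutralSectorsTermwise
import Literature.Analysis.ValidatedNumerics.ParametricIntervalMatrixPosSemidef
import Literature.LinearAlgebra.Matrix.SylvesterCriterion
import HarnessLib

/-!
# O(2) `{φ, s, t}` scan: head matrices of the neutral sectors and the reader's enclosure test

[cite: ChesterEtAl2020, §3.1 (functional conditions), App. «Crossing vectors»]
[cite: HogervorstRychkov2013, §3 eqs. (3.6), (3.9)]
[cite: KosPolandSimmonsduffin2014, §3.3 eq. (3.16)] [cite: Hladik2017, Thm. 1] [cite: Rohn1996Checking, §3.4 eq. (3.4)]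

WHAT THIS FILE DOES (engines lane SDP-4, O(2) client path; Lean side only).  `O2NeutralSectorsTermwise`
reduces the three NEUTRAL sector conditions `0⁺` (`3 × 3`), `0⁻` (`2 × 2`), `4` (scalar) of a scan
functional `F` at a regular `(Δ, ℓ)` to: a finite HEAD `Σ_{(n,j) ∈ S} (A_{n,j}/λ_ℓ) q_{Δ+n,j}` nonnegative
as a quadratic form, plus termwise nonnegativity of the tail.  Here the head is packaged as a MATRIX and the
matrix test a certificate reader runs is stated:
* §1 the `0⁺` TERM MATRIX `termMatrix0p F D E j : Matrix (Fin 3) (Fin 3) ℝ` (six explicit combinations of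
  node numbers) with `sector0pTermForm = xᵀ · termMatrix0p · x` (`x = (a,b,c)`), symmetric; the `0⁻` term
  matrix `termMatrix0m` (`2 × 2`) likewise;
* §2 the HEAD MATRICES `headMatrix0p F D Δ ℓ S = Σ_{q ∈ S} (A_q/λ_ℓ) • termMatrix0p F D (Δ+n) j` and
  `headMatrix0m`, with the head sums of `O2NeutralSectorsTermwise` equal to their quadratic forms
  (`headSum0p_eq_form`, `headSum0m_eq_form`), symmetric;
* §3 the MATRIX RULES: `headMatrix0p ⪰ 0` + tail term matrices `⪰ 0` ⇒ `Pos0p` (`pos0p_of_headMatrix`),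
  and the same for `0⁻`;
* §4 the READER'S ENCLOSURE TEST (numbers a verifier certifies by rational arithmetic): lower bounds
  `lo_i ≤ (headMatrix)_ii`, radii `|(headMatrix)_ij| ≤ r_ij` and the `2^{n-1}` sign–radius matrices of
  `(lo, r)` positive semidefinite (`ParametricIntervalPosSemidef.posSemidef_of_forall_signRadMatrix`,
  Rohn/Hladík) ⇒ `Pos0p` (`pos0p_of_headEnclosure`); for `0⁻` the closed-form `2 × 2` bounds test
  (`pos0m_of_headBounds`); each sign–radius matrix is in turn certified by its principal minors
  (`posSemidef_fin_three_of_leadingMinors`, from `SylvesterCriterion`; the general test is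
  `Literature.LinearAlgebra.Matrix.posSemidef_of_principalMinors_nonneg`).

HONEST SCOPE.  (i) A POINT `(Δ, ℓ)` at a time: the enclosures `lo, r` are hypotheses about six real numbers;
making them UNIFORM on a cell `Δ ∈ [Δ_a, Δ_b]` (monotonicity of `A_{n,j}(Δ, ℓ) Φ_r[𝒫_{Δ+n,j}]` in `Δ`) is the
cell layer, not in this file — §4 only records the pointwise-on-a-set wrapper.  (ii) The tail hypotheses are
termwise matrix positivity for the infinitely many `(n, j)` outside `S`; a uniform tail bound (the analogue of
the `σ–ε` even-row tail) is a separate file.  (iii) Charged sectors `1, 2±, 3` untreated (unequal external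
dimensions).  (iv) Nothing here decides any instance: every number is an input a client cell's verifier
supplies and certifies.  honest framing: shared numerical engines serving client cells; rigour lives in the
verifiers; every published number belongs to a client cell's ledger, not to the engines group.

DECLARATIONS.  This file declares definitions (`termMatrix0p`, `termMatrix0m`, `headMatrix0p`,
`headMatrix0m`) and theorems about them; it is filed as kind `definition`.

Sources.  S. M. Chester, W. Landry, J. Liu, D. Poland, D. Simmons-Duffin, N. Su, A. Vichi, *Carving out
OPE space and precise O(2) model critical exponents*, JHEP 06 (2020) 142, §3.1 (the functional conditions
`α(V⃗) ⪰ 0` sector by sector), App. «Crossing vectors» (`ChesterEtAl2020`).  M. Hogervorst, S. Rychkov,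
*Radial coordinates for conformal blocks*, Phys. Rev. D 87 (2013) 106004, §3 eqs. (3.6), (3.9) (positive
`z`-series) (`HogervorstRychkov2013`).  F. Kos, D. Poland, D. Simmons-Duffin, *Bootstrapping mixed
correlators in the 3D Ising model*, JHEP 11 (2014) 109, §3.3 eq. (3.16) (matrix functional conditions)
(`KosPolandSimmonsduffin2014`).  M. Hladík, *Positive semidefiniteness and positive definiteness of a linear
parametric interval matrix*, (2017), Thm. 1 (`Hladik2017`).  J. Rohn, *Checking properties of interval
matrices*, Tech. Rep. 686 (1996), §3.4 eq. (3.4), Thm. 21 (`Rohn1996Checking`).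
-/

namespace Literature.MathematicalPhysics.QuantumFieldTheory.O2NeutralSectorsHead

open Finset Set Matrix
open Literature.MathematicalPhysics.QuantumFieldTheory.O2ThreeScalarCrossing
open Literature.MathematicalPhysics.QuantumFieldTheory.O2ThreeScalarSystem
open Literature.MathematicalPhysics.QuantumFieldTheory.O2OPEScanBridge
open Literature.MathematicalPhysics.QuantumFieldTheory.O2ScanObligations
open Literature.MathematicalPhysics.QuantumFieldTheory.O2NeutralSectorsTermwise
open Literature.Analysis.ValidatedNumerics.ParametricIntervalPosSemidef (signRadMatrix
  posSemidef_of_forall_signRadMatrix posSemidef_symm_fin_two_of_bounds)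
open ConformalBootstrap3D (IsConformalBlock3D unitarityBound3D accidentalDegeneracy3D crossF zMono hrCoeff
  legendreLam InDescendantRange)

/-! ### §1 Term matrices -/

/-- **The `0⁺` term matrix at `𝒫_{E,j}`**: the symmetric `3 × 3` matrix of the quadratic form
`sector0pTermForm F D E j` in `(a, b, c)` — diagonal `2Φ₁₂[F⁻_{ss}]`, `2Φ₀[F⁻_{φφ}] − 2Φ₂[F⁺_{φφ}]`,
`2Φ₃[F⁻_{tt}] − 2Φ₅[F⁺_{tt}]`; off-diagonal `Φ₁₇[F⁻_{φs}] + Φ₁₈[F⁺_{φs}]` (`ab`), `Φ₁₅[F⁻_{ts}] + Φ₁₆[F⁺_{ts}]`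
(`ac`), `Φ₈ + Φ₉ − Φ₁₀ − Φ₁₁` of `F^∓_{tφ}` (`bc`), all blocks the monomial `𝒫_{E,j}`.
[cite: ChesterEtAl2020, App. «Crossing vectors» (`V⃗_{0⁺,Δ,ℓ⁺}`)] [cite: HogervorstRychkov2013, §3 eq. (3.9)] -/
noncomputable def termMatrix0p (F : ScanFunctional) (D : Dims) (E : ℝ) (j : ℕ) : Matrix (Fin 3) (Fin 3) ℝ :=
  let Φ : Fin 22 → Label → ℝ → ℝ := fun r L sgn => nodeEval F r (crossF (D.expo L) sgn (zMono E j))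
  !![2 * Φ 12 .ssss (-1), Φ 17 .φφss (-1) + Φ 18 .φφss 1, Φ 15 .ttss (-1) + Φ 16 .ttss 1;
     Φ 17 .φφss (-1) + Φ 18 .φφss 1, 2 * Φ 0 .φφφφ (-1) - 2 * Φ 2 .φφφφ 1,
       Φ 8 .ttφφ (-1) + Φ 9 .ttφφ (-1) - Φ 10 .ttφφ 1 - Φ 11 .ttφφ 1;
     Φ 15 .ttss (-1) + Φ 16 .ttss 1, Φ 8 .ttφφ (-1) + Φ 9 .ttφφ (-1) - Φ 10 .ttφφ 1 - Φ 11 .ttφφ 1,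
       2 * Φ 3 .tttt (-1) - 2 * Φ 5 .tttt 1]

/-- The `0⁺` term form is the quadratic form of the `0⁺` term matrix.
[cite: ChesterEtAl2020, App. «Crossing vectors» (`V⃗_{0⁺,Δ,ℓ⁺}`)] -/
theorem sector0pTermForm_eq_form (F : ScanFunctional) (D : Dims) (E : ℝ) (j : ℕ) (a b c : ℝ) :
    sector0pTermForm F D E j a b c = ![a, b, c] ⬝ᵥ (termMatrix0p F D E j *ᵥ ![a, b, c]) := by
  simp [sector0pTermForm, sector0pForm, termMatrix0p, Matrix.mulVec, dotProduct, Fin.sum_univ_three]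
  ring

/-- The `0⁺` term matrix is symmetric. [cite: ChesterEtAl2020, App. «Crossing vectors» (`V⃗_{0⁺,Δ,ℓ⁺}`)] -/
theorem isHermitian_termMatrix0p (F : ScanFunctional) (D : Dims) (E : ℝ) (j : ℕ) :
    (termMatrix0p F D E j).IsHermitian := by
  refine Matrix.IsHermitian.ext fun i k => ?_
  fin_cases i <;> fin_cases k <;> simp [termMatrix0p]

/-- **The `0⁻` term matrix at `𝒫_{E,j}`** (`2 × 2`, in `(b, c)`): diagonal `2Φ₀ − 4Φ₁ + 2Φ₂` of
`F^{−,−,+}_{φφ}`, `2Φ₃ − 4Φ₄ + 2Φ₅` of `F^{−,−,+}_{tt}`; off-diagonal `−Φ₈ + Φ₉ + Φ₁₀ − Φ₁₁` of `F^{∓}_{tφ}`.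
[cite: ChesterEtAl2020, App. «Crossing vectors» (`V⃗_{0⁻,Δ,ℓ⁻}`)] [cite: HogervorstRychkov2013, §3 eq. (3.9)] -/
noncomputable def termMatrix0m (F : ScanFunctional) (D : Dims) (E : ℝ) (j : ℕ) : Matrix (Fin 2) (Fin 2) ℝ :=
  let Φ : Fin 22 → Label → ℝ → ℝ := fun r L sgn => nodeEval F r (crossF (D.expo L) sgn (zMono E j))
  !![2 * Φ 0 .φφφφ (-1) - 4 * Φ 1 .φφφφ (-1) + 2 * Φ 2 .φφφφ 1,
       -Φ 8 .ttφφ (-1) + Φ 9 .ttφφ (-1) + Φ 10 .ttφφ 1 - Φ 11 .ttφφ 1;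
     -Φ 8 .ttφφ (-1) + Φ 9 .ttφφ (-1) + Φ 10 .ttφφ 1 - Φ 11 .ttφφ 1,
       2 * Φ 3 .tttt (-1) - 4 * Φ 4 .tttt (-1) + 2 * Φ 5 .tttt 1]

/-- The `0⁻` term form is the quadratic form of the `0⁻` term matrix.
[cite: ChesterEtAl2020, App. «Crossing vectors» (`V⃗_{0⁻,Δ,ℓ⁻}`)] -/
theorem sector0mTermForm_eq_form (F : ScanFunctional) (D : Dims) (E : ℝ) (j : ℕ) (b c : ℝ) :
    sector0mTermForm F D E j b c = ![b, c] ⬝ᵥ (termMatrix0m F D E j *ᵥ ![b, c]) := by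
  simp [sector0mTermForm, sector0mForm, termMatrix0m, Matrix.mulVec, dotProduct, Fin.sum_univ_two]
  ring

/-- The `0⁻` term matrix is symmetric. [cite: ChesterEtAl2020, App. «Crossing vectors» (`V⃗_{0⁻,Δ,ℓ⁻}`)] -/
theorem isHermitian_termMatrix0m (F : ScanFunctional) (D : Dims) (E : ℝ) (j : ℕ) :
    (termMatrix0m F D E j).IsHermitian := by
  refine Matrix.IsHermitian.ext fun i k => ?_
  fin_cases i <;> fin_cases k <;> simp [termMatrix0m]

/-- A tail TERM of sector `0⁺` is `≥ 0` as a form once its term matrix is positive semidefinite.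
[cite: KosPolandSimmonsduffin2014, §3.3 eq. (3.16)] -/
theorem sector0pTermForm_nonneg_of_posSemidef {F : ScanFunctional} {D : Dims} {E : ℝ} {j : ℕ}
    (h : (termMatrix0p F D E j).PosSemidef) (a b c : ℝ) : 0 ≤ sector0pTermForm F D E j a b c := by
  rw [sector0pTermForm_eq_form]
  simpa using h.dotProduct_mulVec_nonneg ![a, b, c]

/-- A tail term of sector `0⁻` is `≥ 0` as a form once its term matrix is positive semidefinite.
[cite: KosPolandSimmonsduffin2014, §3.3 eq. (3.16)] -/
theorem sector0mTermForm_nonneg_of_posSemidef {F : ScanFunctional} {D : Dims} {E : ℝ} {j : ℕ}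
    (h : (termMatrix0m F D E j).PosSemidef) (b c : ℝ) : 0 ≤ sector0mTermForm F D E j b c := by
  rw [sector0mTermForm_eq_form]
  simpa using h.dotProduct_mulVec_nonneg ![b, c]

/-! ### §2 Head matrices -/

/-- **The `0⁺` head matrix** over a finite index set `S`:
`Σ_{(n,j) ∈ S} (A_{n,j}(Δ,ℓ)/λ_ℓ) • termMatrix0p F D (Δ + n) j`. [cite: HogervorstRychkov2013, §3 eqs. (3.6), (3.9)]
[cite: KosPolandSimmonsduffin2014, §3.3 eq. (3.16)] -/
noncomputable def headMatrix0p (F : ScanFunctional) (D : Dims) (Δ : ℝ) (ℓ : ℕ) (S : Finset (ℕ × ℕ)) :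
    Matrix (Fin 3) (Fin 3) ℝ :=
  ∑ q ∈ S, (hrCoeff Δ ℓ q.1 q.2 / legendreLam ℓ) • termMatrix0p F D (Δ + (q.1 : ℝ)) q.2

/-- **The `0⁻` head matrix.** [cite: HogervorstRychkov2013, §3 eqs. (3.6), (3.9)]
[cite: KosPolandSimmonsduffin2014, §3.3 eq. (3.16)] -/
noncomputable def headMatrix0m (F : ScanFunctional) (D : Dims) (Δ : ℝ) (ℓ : ℕ) (S : Finset (ℕ × ℕ)) :
    Matrix (Fin 2) (Fin 2) ℝ :=
  ∑ q ∈ S, (hrCoeff Δ ℓ q.1 q.2 / legendreLam ℓ) • termMatrix0m F D (Δ + (q.1 : ℝ)) q.2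

/-- The quadratic form of a finite weighted sum of matrices is the weighted sum of the forms (bookkeeping).
[cite: Hladik2017, §2 (the parametric matrix `A(p) = Σ p_k A_k`)] -/
theorem form_finsetSum_smul {m : Type*} [Fintype m] {α : Type*} (T : Finset α) (c : α → ℝ)
    (A : α → Matrix m m ℝ) (x : m → ℝ) :
    x ⬝ᵥ ((∑ q ∈ T, c q • A q) *ᵥ x) = ∑ q ∈ T, c q * (x ⬝ᵥ (A q *ᵥ x)) := by
  rw [Matrix.sum_mulVec, dotProduct_sum]
  refine Finset.sum_congr rfl fun q _ => ?_
  rw [Matrix.smul_mulVec, dotProduct_smul, smul_eq_mul]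

/-- A finite weighted sum of symmetric real matrices is symmetric (bookkeeping).
[cite: Hladik2017, §2 (the parametric matrix `A(p) = Σ p_k A_k`)] -/
theorem isHermitian_finsetSum_smul {m : Type*} {α : Type*} (T : Finset α) (c : α → ℝ)
    {A : α → Matrix m m ℝ} (hA : ∀ q, (A q).IsHermitian) : (∑ q ∈ T, c q • A q).IsHermitian := by
  refine Matrix.IsHermitian.ext fun i k => ?_
  simp only [star_trivial, Matrix.sum_apply, Matrix.smul_apply, smul_eq_mul]
  exact Finset.sum_congr rfl fun q _ => by
    have h := (hA q).apply i k
    rw [star_trivial] at h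
    rw [h]

/-- The `0⁺` head sum of `O2NeutralSectorsTermwise` is the quadratic form of the `0⁺` head matrix.
[cite: KosPolandSimmonsduffin2014, §3.3 eq. (3.16)] -/
theorem headSum0p_eq_form (F : ScanFunctional) (D : Dims) (Δ : ℝ) (ℓ : ℕ) (S : Finset (ℕ × ℕ))
    (a b c : ℝ) :
    ∑ q ∈ S, hrCoeff Δ ℓ q.1 q.2 / legendreLam ℓ * sector0pTermForm F D (Δ + (q.1 : ℝ)) q.2 a b c =
      ![a, b, c] ⬝ᵥ (headMatrix0p F D Δ ℓ S *ᵥ ![a, b, c]) := by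
  rw [headMatrix0p, form_finsetSum_smul]
  simp only [sector0pTermForm_eq_form]

/-- The `0⁻` head sum is the quadratic form of the `0⁻` head matrix. [cite: KosPolandSimmonsduffin2014, §3.3 eq. (3.16)] -/
theorem headSum0m_eq_form (F : ScanFunctional) (D : Dims) (Δ : ℝ) (ℓ : ℕ) (S : Finset (ℕ × ℕ))
    (b c : ℝ) :
    ∑ q ∈ S, hrCoeff Δ ℓ q.1 q.2 / legendreLam ℓ * sector0mTermForm F D (Δ + (q.1 : ℝ)) q.2 b c =
      ![b, c] ⬝ᵥ (headMatrix0m F D Δ ℓ S *ᵥ ![b, c]) := by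
  rw [headMatrix0m, form_finsetSum_smul]
  simp only [sector0mTermForm_eq_form]

/-- The `0⁺` head matrix is symmetric. [cite: KosPolandSimmonsduffin2014, §3.3 eq. (3.16)] -/
theorem isHermitian_headMatrix0p (F : ScanFunctional) (D : Dims) (Δ : ℝ) (ℓ : ℕ) (S : Finset (ℕ × ℕ)) :
    (headMatrix0p F D Δ ℓ S).IsHermitian :=
  isHermitian_finsetSum_smul S _ fun q => isHermitian_termMatrix0p F D _ q.2

/-- The `0⁻` head matrix is symmetric. [cite: KosPolandSimmonsduffin2014, §3.3 eq. (3.16)] -/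
theorem isHermitian_headMatrix0m (F : ScanFunctional) (D : Dims) (Δ : ℝ) (ℓ : ℕ) (S : Finset (ℕ × ℕ)) :
    (headMatrix0m F D Δ ℓ S).IsHermitian :=
  isHermitian_finsetSum_smul S _ fun q => isHermitian_termMatrix0m F D _ q.2

/-! ### §3 Matrix rules -/

/-- **The `0⁺` sector form is `≥ 0` from a PSD head matrix and PSD tail term matrices** (regular point;
`z`-level: every family `G` of genuine `z`-coordinate blocks on the `0⁺` labels).
[cite: HogervorstRychkov2013, §3 eqs. (3.6), (3.9)] [cite: KosPolandSimmonsduffin2014, §3.3 eq. (3.16)] -/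
theorem sector0pForm_nonneg_of_headMatrix (F : ScanFunctional) (D : Dims) {Δ : ℝ} {ℓ : ℕ}
    (hΔ : unitarityBound3D ℓ < Δ) (hreg : ¬ accidentalDegeneracy3D Δ ℓ) (S : Finset (ℕ × ℕ))
    (hhead : (headMatrix0p F D Δ ℓ S).PosSemidef)
    (htail : ∀ q : ℕ × ℕ, q ∉ S → InDescendantRange ℓ q.1 q.2 →
      (termMatrix0p F D (Δ + (q.1 : ℝ)) q.2).PosSemidef)
    {G : Label → ℝ → ℝ → ℝ} (hG : ∀ L ∈ labels0p, IsConformalBlock3D 0 0 Δ ℓ (G L)) (a b c : ℝ) :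
    0 ≤ sector0pForm F D G a b c :=
  sector0pForm_nonneg_of_termwise F D hΔ hreg S
    (fun a b c => by
      rw [headSum0p_eq_form]
      simpa using hhead.dotProduct_mulVec_nonneg ![a, b, c])
    (fun q hq hr => sector0pTermForm_nonneg_of_posSemidef (htail q hq hr)) hG a b c

/-- **The `0⁻` sector form is `≥ 0` from a PSD head matrix and PSD tail term matrices** (regular point).
[cite: HogervorstRychkov2013, §3 eqs. (3.6), (3.9)] [cite: KosPolandSimmonsduffin2014, §3.3 eq. (3.16)] -/
theorem sector0mForm_nonneg_of_headMatrix (F : ScanFunctional) (D : Dims) {Δ : ℝ} {ℓ : ℕ}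
    (hΔ : unitarityBound3D ℓ < Δ) (hreg : ¬ accidentalDegeneracy3D Δ ℓ) (S : Finset (ℕ × ℕ))
    (hhead : (headMatrix0m F D Δ ℓ S).PosSemidef)
    (htail : ∀ q : ℕ × ℕ, q ∉ S → InDescendantRange ℓ q.1 q.2 →
      (termMatrix0m F D (Δ + (q.1 : ℝ)) q.2).PosSemidef)
    {G : Label → ℝ → ℝ → ℝ} (hG : ∀ L ∈ labels0m, IsConformalBlock3D 0 0 Δ ℓ (G L)) (b c : ℝ) :
    0 ≤ sector0mForm F D G b c :=
  sector0mForm_nonneg_of_termwise F D hΔ hreg S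
    (fun b c => by
      rw [headSum0m_eq_form]
      simpa using hhead.dotProduct_mulVec_nonneg ![b, c])
    (fun q hq hr => sector0mTermForm_nonneg_of_posSemidef (htail q hq hr)) hG b c

/-- **Sector `0⁺` from a PSD head matrix and PSD tail term matrices** (regular point).
[cite: HogervorstRychkov2013, §3 eqs. (3.6), (3.9)] [cite: KosPolandSimmonsduffin2014, §3.3 eq. (3.16)]
[cite: ChesterEtAl2020, §3.1 (functional conditions)] -/
theorem pos0p_of_headMatrix (F : ScanFunctional) (D : Dims) {Δ : ℝ} {ℓ : ℕ}
    (hΔ : unitarityBound3D ℓ < Δ) (hreg : ¬ accidentalDegeneracy3D Δ ℓ) (S : Finset (ℕ × ℕ))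
    (hhead : (headMatrix0p F D Δ ℓ S).PosSemidef)
    (htail : ∀ q : ℕ × ℕ, q ∉ S → InDescendantRange ℓ q.1 q.2 →
      (termMatrix0p F D (Δ + (q.1 : ℝ)) q.2).PosSemidef) :
    Pos0p F.toFunctional D Δ ℓ :=
  pos0p_of_forall_sector0pForm_nonneg F D fun _ hG =>
    sector0pForm_nonneg_of_headMatrix F D hΔ hreg S hhead htail hG

/-- **Sector `0⁻` from a PSD head matrix and PSD tail term matrices** (regular point).
[cite: HogervorstRychkov2013, §3 eqs. (3.6), (3.9)] [cite: KosPolandSimmonsduffin2014, §3.3 eq. (3.16)]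
[cite: ChesterEtAl2020, §3.1 (functional conditions)] -/
theorem pos0m_of_headMatrix (F : ScanFunctional) (D : Dims) {Δ : ℝ} {ℓ : ℕ}
    (hΔ : unitarityBound3D ℓ < Δ) (hreg : ¬ accidentalDegeneracy3D Δ ℓ) (S : Finset (ℕ × ℕ))
    (hhead : (headMatrix0m F D Δ ℓ S).PosSemidef)
    (htail : ∀ q : ℕ × ℕ, q ∉ S → InDescendantRange ℓ q.1 q.2 →
      (termMatrix0m F D (Δ + (q.1 : ℝ)) q.2).PosSemidef) :
    Pos0m F.toFunctional D Δ ℓ :=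
  pos0m_of_forall_sector0mForm_nonneg F D fun _ hG =>
    sector0mForm_nonneg_of_headMatrix F D hΔ hreg S hhead htail hG

/-! ### §4 The reader's enclosure tests -/

/-- **Sector `0⁺` from an ENTRYWISE ENCLOSURE of the head matrix** (the numbers a verifier certifies):
lower bounds `lo_i ≤ H_ii`, radii `|H_ij| ≤ r_ij` (`i ≠ j`) for `H = headMatrix0p F D Δ ℓ S`, and the
sign–radius matrices `S_z(lo, r)` (`z ∈ {±}³`; four up to a global flip) positive semidefinite — then
`H ⪰ 0` (Rohn–Hladík vertex test with one-sided diagonal bounds), hence with PSD tail terms `Pos0p`.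
[cite: Hladik2017, Thm. 1 ((2) ⇒ (1))] [cite: Rohn1996Checking, §3.4 eq. (3.4)]
[cite: KosPolandSimmonsduffin2014, §3.3 eq. (3.16)] -/
theorem pos0p_of_headEnclosure (F : ScanFunctional) (D : Dims) {Δ : ℝ} {ℓ : ℕ}
    (hΔ : unitarityBound3D ℓ < Δ) (hreg : ¬ accidentalDegeneracy3D Δ ℓ) (S : Finset (ℕ × ℕ))
    {lo : Fin 3 → ℝ} {r : Matrix (Fin 3) (Fin 3) ℝ}
    (hvert : ∀ z : Fin 3 → Bool, (signRadMatrix lo r z).PosSemidef)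
    (hdiag : ∀ i, lo i ≤ headMatrix0p F D Δ ℓ S i i)
    (hoff : ∀ i k, i ≠ k → |headMatrix0p F D Δ ℓ S i k| ≤ r i k)
    (htail : ∀ q : ℕ × ℕ, q ∉ S → InDescendantRange ℓ q.1 q.2 →
      (termMatrix0p F D (Δ + (q.1 : ℝ)) q.2).PosSemidef) :
    Pos0p F.toFunctional D Δ ℓ :=
  pos0p_of_headMatrix F D hΔ hreg S
    (posSemidef_of_forall_signRadMatrix hvert (isHermitian_headMatrix0p F D Δ ℓ S) hdiag hoff) htail

/-- **Sector `0⁻` from the closed-form `2 × 2` bounds test** on the head matrix: `0 ≤ l₁₁ ≤ H₁₁`,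
`0 ≤ l₂₂ ≤ H₂₂`, `H₁₂ ∈ [l₁₂, h₁₂]`, `max(l₁₂·l₁₂, h₁₂·h₁₂) ≤ l₁₁ l₂₂`; with PSD tail terms, `Pos0m`.
[cite: Hladik2017, Prop. 2] [cite: KosPolandSimmonsduffin2014, §3.3 eq. (3.16)] -/
theorem pos0m_of_headBounds (F : ScanFunctional) (D : Dims) {Δ : ℝ} {ℓ : ℕ}
    (hΔ : unitarityBound3D ℓ < Δ) (hreg : ¬ accidentalDegeneracy3D Δ ℓ) (S : Finset (ℕ × ℕ))
    {l₁₁ l₂₂ l₁₂ h₁₂ : ℝ} (h1 : 0 ≤ l₁₁) (h2 : 0 ≤ l₂₂) (hdet : max (l₁₂ * l₁₂) (h₁₂ * h₁₂) ≤ l₁₁ * l₂₂)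
    (hb11 : l₁₁ ≤ headMatrix0m F D Δ ℓ S 0 0) (hb22 : l₂₂ ≤ headMatrix0m F D Δ ℓ S 1 1)
    (hb12 : l₁₂ ≤ headMatrix0m F D Δ ℓ S 0 1 ∧ headMatrix0m F D Δ ℓ S 0 1 ≤ h₁₂)
    (htail : ∀ q : ℕ × ℕ, q ∉ S → InDescendantRange ℓ q.1 q.2 →
      (termMatrix0m F D (Δ + (q.1 : ℝ)) q.2).PosSemidef) :
    Pos0m F.toFunctional D Δ ℓ := by
  have hH : headMatrix0m F D Δ ℓ S =
      !![headMatrix0m F D Δ ℓ S 0 0, headMatrix0m F D Δ ℓ S 0 1;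
        headMatrix0m F D Δ ℓ S 0 1, headMatrix0m F D Δ ℓ S 1 1] := by
    have hsym := (isHermitian_headMatrix0m F D Δ ℓ S).apply 1 0
    rw [star_trivial] at hsym
    ext i k; fin_cases i <;> fin_cases k <;> simp [hsym]
  refine pos0m_of_headMatrix F D hΔ hreg S ?_ htail
  rw [hH]
  exact posSemidef_symm_fin_two_of_bounds h1 h2 hdet hb11 hb22 hb12

/-- **A symmetric `3 × 3` matrix is PSD from its leading minors** (`A₁₁ > 0`, `A₁₁A₂₂ − A₁₂A₂₁ > 0`,
`det A ≥ 0`) — the rational-arithmetic check a verifier performs on each of the four sign–radius matrices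
when they are nonsingular in the leading block (the general principal-minor test is
`Literature.LinearAlgebra.Matrix.posSemidef_of_principalMinors_nonneg`). [cite: HornJohnson2013, Thm. 7.2.5 (c)] -/
theorem posSemidef_fin_three_of_leadingMinors {A : Matrix (Fin 3) (Fin 3) ℝ} (hA : A.IsHermitian)
    (h1 : 0 < A 0 0) (h2 : 0 < A 0 0 * A 1 1 - A 0 1 * A 1 0) (h3 : 0 ≤ A.det) : A.PosSemidef := by
  refine Literature.LinearAlgebra.Matrix.posSemidef_of_leadingMinors_pos_of_det_nonneg hA (fun k hk => ?_) h3
  interval_cases k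
  · simp
  · rw [Matrix.det_fin_one]
    simpa using h1
  · rw [Matrix.det_fin_two]
    simpa using h2

/-- **The enclosure test on a parameter set** (a cell of `(Δ, ℓ)` values at fixed `ℓ`, all regular): the
same four sign–radius matrices checked ONCE, with enclosures valid at every `Δ ∈ C`, give `Pos0p` on all
of `C`. [cite: Hladik2017, Thm. 1 ((2) ⇒ (1))] [cite: KosPolandSimmonsduffin2014, §3.3 eq. (3.16)] -/
theorem forall_pos0p_of_headEnclosure (F : ScanFunctional) (D : Dims) {ℓ : ℕ} {C : Set ℝ}
    (hC : ∀ Δ ∈ C, unitarityBound3D ℓ < Δ ∧ ¬ accidentalDegeneracy3D Δ ℓ) (S : Finset (ℕ × ℕ))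
    {lo : Fin 3 → ℝ} {r : Matrix (Fin 3) (Fin 3) ℝ}
    (hvert : ∀ z : Fin 3 → Bool, (signRadMatrix lo r z).PosSemidef)
    (hdiag : ∀ Δ ∈ C, ∀ i, lo i ≤ headMatrix0p F D Δ ℓ S i i)
    (hoff : ∀ Δ ∈ C, ∀ i k, i ≠ k → |headMatrix0p F D Δ ℓ S i k| ≤ r i k)
    (htail : ∀ Δ ∈ C, ∀ q : ℕ × ℕ, q ∉ S → InDescendantRange ℓ q.1 q.2 →
      (termMatrix0p F D (Δ + (q.1 : ℝ)) q.2).PosSemidef) :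
    ∀ Δ ∈ C, Pos0p F.toFunctional D Δ ℓ := fun Δ hΔC =>
  pos0p_of_headEnclosure F D (hC Δ hΔC).1 (hC Δ hΔC).2 S hvert (hdiag Δ hΔC) (hoff Δ hΔC) (htail Δ hΔC)

end Literature.MathematicalPhysics.QuantumFieldTheory.O2NeutralSectorsHead
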